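import Summits.SmoothPoincare4.SmoothPoincare4.Theorems.EntropyRungNoncompactGapReduction
import Summits.SmoothPoincare4.SmoothPoincare4.Theorems.EntropyRungNoncompactShrinkerGapStubCompactSupportLSIHeat

/-!
# Crux `EntropyRung.NoncompactShrinkerGap` (stmt-SmoothPoincare4-10868) from FOUR route items: the glue with the
# compact-support logarithmic Sobolev inequality PROVED (line `collapsed-ends-usc`, skeleton v14; lead c9)

The landed glue `noncompactGapReduction_proof` (Theorems/EntropyRungNoncompactGapReduction.lean, p123839) derives the crux
from FIVE route items, among them the general Bakry–Émery item `BakryEmeryLogSobolev` (stmt-SmoothPoincare4-16587: the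
logarithmic Sobolev inequality of EVERY complete `CD(K,∞)` weighted manifold — XL). The lever consumes it at exactly one
place, the compact-support LSI of the shrinker measure, which is now a THEOREM
(`NoncompactShrinkerGapHeat.stub_compactSupportLSI`, Theorems/EntropyRungNoncompactShrinkerGapStubCompactSupportLSIHeat.lean:
the Bakry–Émery heat flow run on the complete shrinker, leads c8/c9). This file re-derives the glue over that theorem:

  `helper_noncompactGapReduction_cs : ThreeShrinkerGap → ShrinkerSplittingAtInfinity → ConicalGap → UnboundedCurvatureGap → NoncompactShrinkerGap`

(registered helper of the crux item), so that item 16587 is no longer on the critical path of the crux. The three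
theorems are the v13/v14 skeleton composition verbatim with the hypothesis `hCS` discharged.
-/

noncomputable section

set_option linter.dupNamespace false

open scoped Manifold ContDiff ENNReal NNReal Topology
open MeasureTheory Set Filter
open Literature.Geometry.Lorentzian Literature.Geometry.Riemannian

namespace Summit.SmoothPoincare4.SmoothPoincare4.Theorems.NoncompactShrinkerGapReductionCs

open Summit.SmoothPoincare4.SmoothPoincare4.Theses.EntropyRung
open Summit.SmoothPoincare4.SmoothPoincare4.Theorems
open Summit.SmoothPoincare4.SmoothPoincare4.Theorems.NoncompactShrinkerGapReduction
open Summit.SmoothPoincare4.SmoothPoincare4.Theorems.NoncompactShrinkerGapReductionTextbook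

/-- **The lever keyed by the compact-support LSI** (copy of the landed `collapsedDirectionReduction_of_textbook` with the
single use of the textbook LSI replaced by the THEOREM `NoncompactShrinkerGapHeat.stub_compactSupportLSI`): for a complete connected non-compact non-flat normalised 4-d shrinker with bounded non-decaying
scalar curvature there is a complete connected non-flat normalised 3-d shrinker `(N, h, φ)` with
`∫_M e^{-f} ≤ 2√π ∫_N e^{-φ}`. [cite: BernsteinWang2016, Thm 1.2, Cor 6.6] -/
theorem collapsedDirectionReduction_cs (hsplit : shrinkerSplittingAtInfinity_four)
    (M : Type) [TopologicalSpace M] [T2Space M] [SecondCountableTopology M]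
    [ChartedSpace (EuclideanSpace ℝ (Fin 4)) M] [IsManifold (𝓡 4) ∞ M] [ConnectedSpace M] [NoncompactSpace M]
    [T3Space M] [MeasurableSpace M] [BorelSpace M]
    (g : PseudoRiemannianMetric (𝓡 4) ∞ (EuclideanSpace ℝ (Fin 4)) (TangentSpace (𝓡 4) : M → Type _))
    [g.HasLeviCivita] (f : M → ℝ) (hg : g.IsRiemannian)
    (hc : ∀ (x : M) (r : NNReal), IsCompact {y : M | g.edist hg x y ≤ r})
    (hf : ContMDiff (𝓡 4) 𝓘(ℝ, ℝ) ∞ f)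
    (hsol : ∀ (x : M) (X Y : TangentSpace (𝓡 4) x),
      g.ricci x X Y + g.hessian f x X Y = (1 / 2 : ℝ) * g.val x X Y)
    (hnorm : ∀ x : M, g.scalarCurvature x + g.gradSq f x = f x)
    (hnf : ∃ x : M, g.scalarCurvature x ≠ 0)
    (hbdd : ∃ C : ℝ, ∀ x : M, g.scalarCurvature x ≤ C)
    (hnd : ∃ ε : ℝ, 0 < ε ∧ ∀ K : Set M, IsCompact K → ∃ x, x ∉ K ∧ ε ≤ g.scalarCurvature x) :
    ∃ (N : Type) (_ : TopologicalSpace N) (_ : T2Space N) (_ : SecondCountableTopology N)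
      (_ : ChartedSpace (EuclideanSpace ℝ (Fin 3)) N) (_ : IsManifold (𝓡 3) ∞ N)
      (_ : ConnectedSpace N) (_ : T3Space N) (_ : MeasurableSpace N) (_ : BorelSpace N)
      (h : PseudoRiemannianMetric (𝓡 3) ∞ (EuclideanSpace ℝ (Fin 3)) (TangentSpace (𝓡 3) : N → Type _))
      (_ : h.HasLeviCivita) (φ : N → ℝ) (hh : h.IsRiemannian),
      (∀ (y : N) (r : NNReal), IsCompact {z : N | h.edist hh y z ≤ r}) ∧
      ContMDiff (𝓡 3) 𝓘(ℝ, ℝ) ∞ φ ∧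
      (∀ (y : N) (X Y : TangentSpace (𝓡 3) y),
        h.ricci y X Y + h.hessian φ y X Y = (1 / 2 : ℝ) * h.val y X Y) ∧
      (∀ y : N, h.scalarCurvature y + h.gradSq φ y = φ y) ∧
      (∃ y : N, h.scalarCurvature y ≠ 0) ∧
      ∫⁻ x, ENNReal.ofReal (Real.exp (-f x)) ∂(riemannianMeasure (g.toContMDiffRiemannianMetric hg)) ≤
        ENNReal.ofReal (2 * Real.sqrt Real.pi) *
          ∫⁻ y, ENNReal.ofReal (Real.exp (-φ y)) ∂(riemannianMeasure (h.toContMDiffRiemannianMetric hh)) := by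
  obtain ⟨N, tN, t2N, scN, chN, mN, cN, t3N, msN, bN, h, lcN, φ, hh, hcN, hφ, hsolN, hnormN, hnfN,
    htrans⟩ := hsplit M g f hg hc hf hsol hnorm hnf hbdd hnd
  refine ⟨N, tN, t2N, scN, chN, mN, cN, t3N, msN, bN, h, lcN, φ, hh, hcN, hφ, hsolN, hnormN, hnfN, ?_⟩
  have hX := shrinkerScalarCurvature_nonneg_holds
  -- Carrillo–Ni (i) on `M` (`n = 4`) and on `N` (`n = 3`) — theorems
  have hAi : Integrable (fun x ↦ Real.exp (-f x)) g.riemVolume :=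
    NoncompactShrinkerGapCarrilloNiClauses.carrilloNi_integrable_exp_neg g f hg hc hf hsol hnorm
  have hBi : Integrable (fun y ↦ Real.exp (-φ y)) h.riemVolume :=
    NoncompactShrinkerGapCarrilloNiClauses.carrilloNi_integrable_exp_neg h φ hh hcN hφ hsolN hnormN
  have hApos : 0 < ∫ x, Real.exp (-f x) ∂g.riemVolume := integral_exp_neg_pos hg hAi
  have hBpos : 0 < ∫ y, Real.exp (-φ y) ∂h.riemVolume := integral_exp_neg_pos hh hBi
  have h2sqrtpi : 0 < 2 * Real.sqrt Real.pi := by positivity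
  have hapos : 0 < (4 * Real.pi) ^ (-(4 : ℝ) / 2) := Real.rpow_pos_of_pos (by positivity) _
  -- the real inequality `∫_M e^{-f} ≤ 2√π ∫_N e^{-φ}` from CS-LSI, U2, U3, `ε` at a time
  have hmain : ∫ x, Real.exp (-f x) ∂g.riemVolume ≤
      2 * Real.sqrt Real.pi * ∫ y, Real.exp (-φ y) ∂h.riemVolume := by
    refine le_of_forall_log_mul_le hapos hApos (mul_pos h2sqrtpi hBpos) fun ε hε ↦ ?_
    obtain ⟨R, W, hWs, hWc, hWsupp, hWZ, hWval⟩ :=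
      NoncompactShrinkerGapModelValueSplitLineOfNonneg.stub_modelValueSplitLine_of_nonneg hX N h φ hh hcN hφ
        hsolN hnormN ε hε
    obtain ⟨η, hη, hη'⟩ :=
      NoncompactShrinkerGapTransplantComparison.stub_transplantComparison M g hg N h hh φ R W hWs hWc hWsupp
        hWZ ε hε
    obtain ⟨U, Φ, Ψ, hU, hsub, hΦ, hΦU, hΨ, hinv, hqi, hscal⟩ := htrans R η hη
    obtain ⟨w, hws, hwc, hwZ, hwval⟩ := hη' U Φ Ψ hU hsub hΦ hΦU hΨ hinv hqi hscal
    have h1 := NoncompactShrinkerGapHeat.stub_compactSupportLSI M g f hg hc hf hsol hnorm hbdd w hws hwc hwZ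
    linarith
  -- conversion to the route's `lintegral`s
  rw [lintegral_exp_neg_eq_ofReal_integral hg hAi, lintegral_exp_neg_eq_ofReal_integral hh hBi,
    ← ENNReal.ofReal_mul h2sqrtpi.le]
  exact ENNReal.ofReal_le_ofReal hmain

/-- **The crux on the bounded-curvature non-conical class, unconditionally in the LSI**: the 3-d rung `ThreeShrinkerGap`
composed with the lever `collapsedDirectionReduction_cs`: `∫_M e^{-f} ≤ 2√π · 16π² e^{-3/2} = 32π²√π e^{-3/2}`.
[cite: BernsteinWang2016, Thm 1.2] -/
theorem nonDecayingGap_cs (hT : ThreeShrinkerGap) (hsplit : ShrinkerSplittingAtInfinity)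
    (M : Type) [TopologicalSpace M] [T2Space M] [SecondCountableTopology M]
    [ChartedSpace (EuclideanSpace ℝ (Fin 4)) M] [IsManifold (𝓡 4) ∞ M] [ConnectedSpace M] [NoncompactSpace M]
    [T3Space M] [MeasurableSpace M] [BorelSpace M]
    (g : PseudoRiemannianMetric (𝓡 4) ∞ (EuclideanSpace ℝ (Fin 4)) (TangentSpace (𝓡 4) : M → Type _))
    [g.HasLeviCivita] (f : M → ℝ) (hg : g.IsRiemannian)
    (hc : ∀ (x : M) (r : NNReal), IsCompact {y : M | g.edist hg x y ≤ r})
    (hf : ContMDiff (𝓡 4) 𝓘(ℝ, ℝ) ∞ f)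
    (hsol : ∀ (x : M) (X Y : TangentSpace (𝓡 4) x),
      g.ricci x X Y + g.hessian f x X Y = (1 / 2 : ℝ) * g.val x X Y)
    (hnorm : ∀ x : M, g.scalarCurvature x + g.gradSq f x = f x)
    (hnf : ∃ x : M, g.scalarCurvature x ≠ 0)
    (hbdd : ∃ C : ℝ, ∀ x : M, g.scalarCurvature x ≤ C)
    (hnd : ∃ ε : ℝ, 0 < ε ∧ ∀ K : Set M, IsCompact K → ∃ x, x ∉ K ∧ ε ≤ g.scalarCurvature x) :
    ∫⁻ x, ENNReal.ofReal (Real.exp (-f x)) ∂(riemannianMeasure (g.toContMDiffRiemannianMetric hg)) ≤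
      ENNReal.ofReal (32 * Real.pi ^ 2 * Real.sqrt Real.pi * Real.exp (-(3 : ℝ) / 2)) := by
  obtain ⟨N, _, _, _, _, _, _, _, _, _, h, _, φ, hh, hcN, hφ, hsolN, hnormN, hnfN, hZ⟩ :=
    collapsedDirectionReduction_cs (shrinkerSplittingAtInfinity_four_of_item hsplit) M g f hg hc hf
      hsol hnorm hnf hbdd hnd
  have h3 : ∫⁻ x, ENNReal.ofReal (Real.exp (-φ x)) ∂(riemannianMeasure (h.toContMDiffRiemannianMetric hh))
      ≤ ENNReal.ofReal (16 * Real.pi ^ 2 * Real.exp (-(3 : ℝ) / 2)) :=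
    hT N h φ hh hcN hφ hsolN hnormN hnfN
  calc ∫⁻ x, ENNReal.ofReal (Real.exp (-f x)) ∂(riemannianMeasure (g.toContMDiffRiemannianMetric hg))
      ≤ ENNReal.ofReal (2 * Real.sqrt Real.pi) * ∫⁻ x, ENNReal.ofReal (Real.exp (-φ x))
          ∂(riemannianMeasure (h.toContMDiffRiemannianMetric hh)) := hZ
    _ ≤ ENNReal.ofReal (2 * Real.sqrt Real.pi) * ENNReal.ofReal (16 * Real.pi ^ 2 * Real.exp (-(3 : ℝ) / 2)) := by
        gcongr
    _ = ENNReal.ofReal (32 * Real.pi ^ 2 * Real.sqrt Real.pi * Real.exp (-(3 : ℝ) / 2)) :=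
        lineFactor_mul_threeBound

/-- **The crux from FOUR inputs** (the compact-support LSI being a theorem): trichotomy on the scalar
curvature at infinity — unbounded `R` ↦ residue 2; bounded decaying `R` ↦ residue 1; bounded non-decaying `R` ↦
splitting at infinity + the (proved) compact-support LSI on the shrinker + the 3-d rung. -/
theorem noncompactShrinkerGap_cs
    (hT : Summit.SmoothPoincare4.SmoothPoincare4.Theses.EntropyRung.ThreeShrinkerGap)
    (hS : Summit.SmoothPoincare4.SmoothPoincare4.Theses.EntropyRung.ShrinkerSplittingAtInfinity)
    (hC : Summit.SmoothPoincare4.SmoothPoincare4.Theses.EntropyRung.ConicalGap)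
    (hD : Summit.SmoothPoincare4.SmoothPoincare4.Theses.EntropyRung.UnboundedCurvatureGap) :
    Summit.SmoothPoincare4.SmoothPoincare4.Theses.EntropyRung.NoncompactShrinkerGap := by
  intro M _ _ _ _ _ _ _ _ _ _ g _ f hg hc hf hsol hnorm hnf
  by_cases hbdd : ∃ C : ℝ, ∀ x : M, g.scalarCurvature x ≤ C
  · by_cases hflat : ∀ ε : ℝ, 0 < ε → ∃ K : Set M, IsCompact K ∧ ∀ x, x ∉ K → g.scalarCurvature x < ε
    · exact hC M g f hg hc hf hsol hnorm hnf hflat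
    · exact nonDecayingGap_cs hT hS M g f hg hc hf hsol hnorm hnf hbdd
        (exists_nondecaying_of_not_flatAtInfinity hflat)
  · exact hD M g f hg hc hf hsol hnorm hnf hbdd

/-- **Helper `helper_noncompactGapReduction_cs`** (crux stmt-SmoothPoincare4-10868, line `collapsed-ends-usc`, v14): the
crux `NoncompactShrinkerGap` from the FOUR route items `ThreeShrinkerGap` (16586), `ShrinkerSplittingAtInfinity` (16588),
`ConicalGap` (16589), `UnboundedCurvatureGap` (16590) — the general Bakry–Émery item 16587 being replaced by the proved
compact-support LSI of the shrinker. [cite: BernsteinWang2016, Thm. 1.2] [cite: CarrilloNi2009, Thm. 1.1] -/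
theorem helper_noncompactGapReduction_cs : Summit.SmoothPoincare4.SmoothPoincare4.Theses.EntropyRung.ThreeShrinkerGap → Summit.SmoothPoincare4.SmoothPoincare4.Theses.EntropyRung.ShrinkerSplittingAtInfinity → Summit.SmoothPoincare4.SmoothPoincare4.Theses.EntropyRung.ConicalGap → Summit.SmoothPoincare4.SmoothPoincare4.Theses.EntropyRung.UnboundedCurvatureGap → Summit.SmoothPoincare4.SmoothPoincare4.Theses.EntropyRung.NoncompactShrinkerGap :=
  fun hT hS hC hD ↦ noncompactShrinkerGap_cs hT hS hC hD

end Summit.SmoothPoincare4.SmoothPoincare4.Theorems.NoncompactShrinkerGapReductionCs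

end
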